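import Literature.Barriers.SmoothPoincare4.CircleActionsStandardOrbitTypes
import Mathlib.Data.ZMod.QuotientGroup
import Mathlib.Topology.Maps.Proper.Basic
import HarnessLib

/-!
# Barrier (SmoothPoincare4): circle actions on homotopy 4-spheres — isotropy structure (proofs companion)

Third proofs companion of `Literature/Barriers/SmoothPoincare4/CircleActionsStandard.lean`
(theorems only, no definitions, no named facts; D-0014/D-0026), continuing
`CircleActionsStandardOrbitTypes.lean` (orbit types `F`, `E`, `P` of a continuous circle
action; closed subgroups of `S¹`). Towards the printed proof of the named fact
`Literature.Barriers.SmoothPoincare4.fintushelPao_circleAction_homotopySphere_four`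
(Fintushel 1977/1978, Pao 1978, Perelman), this file adds the part of the isotropy
bookkeeping that the weighted orbit space needs beyond the pointwise trichotomy:

* `Circle.orderOf_exp_two_pi_div`, `Circle.subgroup_eq_zpowers_exp_of_finite`: a finite
  subgroup of `S¹` of order `k` is generated by `e^{2πi/k}` — the isotropy type "`ℤₖ`" of an
  exceptional orbit is the single integer `k` (the orbit invariant entering Fintushel's weights);
* `CircleAction.smul_mem_setOf_stabilizer_iff`: isotropy groups are constant along orbits (the
  circle is abelian; Mathlib's `MulAction.stabilizer_smul_eq_right`), so `F`, `E`, `P` are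
  unions of orbits and descend to subsets `F*`, `E*`, `P*` of the orbit space `M*`;
* `CircleAction.stabilizer_trichotomy`: `F` / `P` / `E` with the exceptional isotropy written
  as `ℤₖ = {z | zᵏ = 1} = ⟨e^{2πi/k}⟩`, `k ≥ 2`;
* `Circle.exists_re_nonpos_of_ne_bot`, `CircleAction.isClosed_setOf_stabilizer_ne_bot`,
  `CircleAction.isOpen_setOf_stabilizer_eq_bot`: **the singular set `E ∪ F` is closed** (and
  the union `P` of the principal orbits is open) for any continuous circle action on a Hausdorff
  space — `E ∪ F` is the projection along the compact factor `S¹` of the closed set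
  `{(g, x) | g • x = x, Re g ≤ 0}`, because every closed subgroup `≠ 1` of `S¹` contains an
  element with `Re g ≤ 0`. (Printed use: `E* ∪ F*` is a closed subcomplex — arcs and circles —
  of the orbit space, Fintushel 1977 §3, 1978 §1; Pao 1978 §1.)

Sources. Fintushel 1978 §1 / Pao 1978 §1 set up `F`, `E`, `P`, `M*` for locally smooth
effective `S¹`-actions on simply connected 4-manifolds (tree docstring of
`CircleActionsStandard.lean`, quoting Pao 1978 §1 (1)); the general-topology statements proved
here are standard transformation-group facts (Bredon 1972, Ch. I; Bourbaki TG III §4) and are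
proved from Mathlib and the sibling file. The named fact stays undischarged (SIZE XL: slice
theorem, equivariant classification, replacement trick, Perelman — see
`CircleActionsStandardProofs.lean`, "Why the fact is not discharged here").

## References

[Fintushel1977] [Fintushel1978] [Pao1978] [Bredon1972] [Bourbaki1995] [Edmonds2009Survey]
-/

noncomputable section

open Set

namespace Literature.Barriers.SmoothPoincare4

/-! ### The generator `e^{2πi/k}` of a finite subgroup of the circle -/

namespace Circle

/-- `e^{2πi/k}` is a `k`-th root of unity in `S¹`. [folklore] -/
theorem exp_two_pi_div_pow_eq_one (k : ℕ) (hk : 0 < k) :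
    _root_.Circle.exp (2 * Real.pi / k) ^ k = 1 := by
  rw [← Circle.exp_natCast_mul]
  have hk' : (k : ℝ) ≠ 0 := by exact_mod_cast hk.ne'
  rw [mul_div_cancel₀ _ hk', Circle.exp_two_pi]

/-- `e^{2πi/k}` has order exactly `k` in `S¹`. [folklore] -/
theorem orderOf_exp_two_pi_div (k : ℕ) (hk : 0 < k) :
    orderOf (_root_.Circle.exp (2 * Real.pi / k)) = k := by
  rw [orderOf_eq_iff hk]
  refine ⟨exp_two_pi_div_pow_eq_one k hk, fun m hm hm0 h => ?_⟩
  rw [← Circle.exp_natCast_mul, Circle.exp_eq_one] at h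
  obtain ⟨n, hn⟩ := h
  have hk' : (0 : ℝ) < k := by exact_mod_cast hk
  have hπ := Real.pi_pos
  have h1 : (m : ℝ) = n * k := by
    field_simp at hn
    nlinarith [hn]
  have h2 : (0 : ℝ) < n := by
    have : (0 : ℝ) < m := by exact_mod_cast hm0
    nlinarith
  have h3 : (n : ℝ) < 1 := by
    have : (m : ℝ) < k := by exact_mod_cast hm
    nlinarith
  have h4 : (0 : ℤ) < n := by exact_mod_cast h2
  have h5 : n < (1 : ℤ) := by exact_mod_cast h3
  omega

/-- Membership in a finite subgroup of `S¹` of order `k` is the equation `zᵏ = 1`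
(`Circle.ker_powMonoidHom_natCard_eq` of the sibling file, pointwise). [folklore] -/
theorem mem_iff_pow_natCard_eq_one_of_finite {H : Subgroup _root_.Circle}
    (hH : (H : Set _root_.Circle).Finite) (z : _root_.Circle) : z ∈ H ↔ z ^ Nat.card H = 1 := by
  conv_lhs => rw [← Circle.ker_powMonoidHom_natCard_eq H hH]
  rw [MonoidHom.mem_ker, powMonoidHom_apply]

/-- **A finite subgroup of `S¹` of order `k` is the cyclic group generated by `e^{2πi/k}`**
(it consists of the `k`-th roots of unity, which contain `e^{2πi/k}`, an element of order
`k`). The isotropy type of an exceptional orbit is thus the single integer `k`.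
[cite: Bredon1972, Ch. I §1] [folklore] -/
theorem subgroup_eq_zpowers_exp_of_finite (H : Subgroup _root_.Circle)
    (hH : (H : Set _root_.Circle).Finite) :
    H = Subgroup.zpowers (_root_.Circle.exp (2 * Real.pi / Nat.card H)) := by
  haveI : Finite H := hH.to_subtype
  have hk : 0 < Nat.card H := Nat.card_pos
  have hmem : _root_.Circle.exp (2 * Real.pi / Nat.card H) ∈ H := by
    rw [mem_iff_pow_natCard_eq_one_of_finite hH]
    exact exp_two_pi_div_pow_eq_one _ hk
  symm
  apply Subgroup.eq_of_le_of_card_ge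
  · rw [Subgroup.zpowers_le]; exact hmem
  · rw [Nat.card_zpowers, orderOf_exp_two_pi_div _ hk]

/-- **Every closed subgroup `≠ 1` of `S¹` contains an element with non-positive real part**
(for `S¹` itself take `-1`; for `ℤₖ`, `k ≥ 2`, take `e^{2πi j/k}` with `j = ⌈k/4⌉`, whose
argument lies in `[π/2, 3π/2]`). `Re g ≤ 0` is a closed condition on `g` excluding `g = 1`;
this is the compactness handle behind `CircleAction.isClosed_setOf_stabilizer_ne_bot`.
[folklore] -/
theorem exists_re_nonpos_of_ne_bot {H : Subgroup _root_.Circle}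
    (hH : IsClosed (H : Set _root_.Circle)) (hbot : H ≠ ⊥) :
    ∃ g ∈ H, ((g : _root_.Circle) : ℂ).re ≤ 0 := by
  rcases Circle.subgroup_eq_top_or_finite_of_isClosed H hH with h | h
  · refine ⟨-1, by rw [h]; exact Subgroup.mem_top _, ?_⟩
    simp
  · haveI : Finite H := h.to_subtype
    set k := Nat.card H with hk_def
    have hk2 : 2 ≤ k := by
      have hnt : Nontrivial H := (Subgroup.nontrivial_iff_ne_bot _).2 hbot
      exact Finite.one_lt_card
    have hkpos : 0 < k := by omega
    set j : ℕ := (k + 3) / 4 with hj_def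
    have hj1 : k ≤ 4 * j := by omega
    have hj2 : 4 * j ≤ k + 3 := by omega
    refine ⟨_root_.Circle.exp (2 * Real.pi * j / k), ?_, ?_⟩
    · rw [mem_iff_pow_natCard_eq_one_of_finite h, ← hk_def, ← Circle.exp_natCast_mul]
      have hk' : (k : ℝ) ≠ 0 := by exact_mod_cast hkpos.ne'
      rw [show (k : ℝ) * (2 * Real.pi * j / k) = j * (2 * Real.pi) by field_simp]
      exact_mod_cast Circle.exp_int_mul_two_pi j
    · rw [Circle.coe_exp, Complex.exp_ofReal_mul_I_re]
      have hπ := Real.pi_pos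
      have hk' : (0 : ℝ) < k := by exact_mod_cast hkpos
      have hj1' : (k : ℝ) ≤ 4 * j := by exact_mod_cast hj1
      have hj2' : 4 * (j : ℝ) ≤ k + 3 := by exact_mod_cast hj2
      have hk2' : (2 : ℝ) ≤ k := by exact_mod_cast hk2
      apply Real.cos_nonpos_of_pi_div_two_le_of_le
      · rw [le_div_iff₀ hk']
        nlinarith
      · rw [div_le_iff₀ hk']
        nlinarith

end Circle

/-! ### Isotropy along orbits; the singular set `E ∪ F` is closed -/

namespace CircleAction

/-- **`F`, `E ∪ F`, `E`, `P` are `S¹`-invariant**: orbit types are constant along orbits — for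
an action of a commutative group (such as `S¹`) the isotropy group of `g • x` equals that of `x`
(Mathlib: `MulAction.stabilizer_smul_eq_right`) — so membership in any set of points cut out by
a condition on the isotropy group is invariant under the action, and these sets descend to
well-defined subsets `F*`, `E*`, `P*` of the orbit space `M* = M/S¹`.
[cite: Fintushel1978, §1] [cite: Bredon1972, Ch. I §1] [folklore] -/
theorem smul_mem_setOf_stabilizer_iff {M : Type*} [MulAction _root_.Circle M]
    (p : Subgroup _root_.Circle → Prop) (g : _root_.Circle) (x : M) :
    g • x ∈ {y : M | p (MulAction.stabilizer _root_.Circle y)} ↔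
      x ∈ {y : M | p (MulAction.stabilizer _root_.Circle y)} := by
  simp only [mem_setOf_eq, MulAction.stabilizer_smul_eq_right]

variable {M : Type*} [TopologicalSpace M] [T2Space M] [MulAction _root_.Circle M]
  [ContinuousSMul _root_.Circle M]

/-- **Orbit-type trichotomy with explicit exceptional isotropy (Fintushel's `F`, `P`, `E`).**
For a continuous circle action on a Hausdorff space every point is a fixed point (isotropy
`S¹`), or has trivial isotropy (principal orbit), or has isotropy the cyclic group
`ℤₖ = {z | zᵏ = 1} = ⟨e^{2πi/k}⟩` of order `k ≥ 2` (exceptional orbit `S¹/ℤₖ`).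
[cite: Fintushel1978, §1] [cite: Pao1978, §1] [cite: Bredon1972, Ch. I §1] -/
theorem stabilizer_trichotomy (x : M) :
    x ∈ MulAction.fixedPoints _root_.Circle M ∨ MulAction.stabilizer _root_.Circle x = ⊥ ∨
      ∃ k : ℕ, 2 ≤ k ∧ Nat.card (MulAction.stabilizer _root_.Circle x) = k ∧
        (∀ z : _root_.Circle, z ∈ MulAction.stabilizer _root_.Circle x ↔ z ^ k = 1) ∧
        MulAction.stabilizer _root_.Circle x =
          Subgroup.zpowers (_root_.Circle.exp (2 * Real.pi / k)) := by
  rcases mem_fixedPoints_or_finite_isCyclic_stabilizer x with h | ⟨hfin, -⟩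
  · exact Or.inl h
  · right
    haveI : Finite (MulAction.stabilizer _root_.Circle x) := hfin.to_subtype
    by_cases hbot : MulAction.stabilizer _root_.Circle x = ⊥
    · exact Or.inl hbot
    · right
      refine ⟨Nat.card (MulAction.stabilizer _root_.Circle x), ?_, rfl,
        Circle.mem_iff_pow_natCard_eq_one_of_finite hfin,
        Circle.subgroup_eq_zpowers_exp_of_finite _ hfin⟩
      have hnt : Nontrivial (MulAction.stabilizer _root_.Circle x) :=
        (Subgroup.nontrivial_iff_ne_bot _).2 hbot
      exact Finite.one_lt_card

/-- **The singular set `E ∪ F` is closed.** For a continuous circle action on a Hausdorff space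
the set of points with nontrivial isotropy (exceptional orbits and fixed points) is closed: it
is the projection along the compact factor `S¹` (a closed map) of the closed set
`{(g, x) | g • x = x, Re g ≤ 0} ⊆ S¹ × M`, by `Circle.exists_re_nonpos_of_ne_bot`.
[cite: Fintushel1978, §1] [cite: Bredon1972, Ch. I §1] -/
theorem isClosed_setOf_stabilizer_ne_bot :
    IsClosed {x : M | MulAction.stabilizer _root_.Circle x ≠ ⊥} := by
  set S : Set (_root_.Circle × M) := {p | p.1 • p.2 = p.2 ∧ ((p.1 : _root_.Circle) : ℂ).re ≤ 0}
    with hS_def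
  have hS : IsClosed S := by
    apply IsClosed.inter
    · exact isClosed_eq (continuous_fst.smul continuous_snd) continuous_snd
    · exact isClosed_le (Complex.continuous_re.comp (continuous_subtype_val.comp continuous_fst))
        continuous_const
  have himage : Prod.snd '' S = {x : M | MulAction.stabilizer _root_.Circle x ≠ ⊥} := by
    ext x
    simp only [mem_image, mem_setOf_eq, Prod.exists, exists_eq_right, hS_def]
    constructor
    · rintro ⟨g, hgx, hg⟩ hbot
      have hg1 : g ∈ MulAction.stabilizer _root_.Circle x := hgx
      rw [hbot, Subgroup.mem_bot] at hg1
      rw [hg1] at hg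
      norm_num at hg
    · intro hbot
      obtain ⟨g, hg, hre⟩ :=
        Circle.exists_re_nonpos_of_ne_bot (CompactGroupAction.isClosed_stabilizer x) hbot
      exact ⟨g, hg, hre⟩
  rw [← himage]
  exact isClosedMap_snd_of_compactSpace S hS

/-- **The union `P` of the principal orbits is open** (complement of the singular set
`E ∪ F`). [cite: Fintushel1978, §1] [cite: Bredon1972, Ch. I §1] -/
theorem isOpen_setOf_stabilizer_eq_bot :
    IsOpen {x : M | MulAction.stabilizer _root_.Circle x = ⊥} := by
  have h : {x : M | MulAction.stabilizer _root_.Circle x = ⊥} =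
      {x : M | MulAction.stabilizer _root_.Circle x ≠ ⊥}ᶜ := by
    ext x; simp
  rw [h]
  exact isClosed_setOf_stabilizer_ne_bot.isOpen_compl

omit [TopologicalSpace M] [T2Space M] [ContinuousSMul _root_.Circle M] in
/-- **`F ⊆ E ∪ F`**: a fixed point has nontrivial (indeed full) isotropy. [folklore] -/
theorem stabilizer_ne_bot_of_mem_fixedPoints {x : M}
    (hx : x ∈ MulAction.fixedPoints _root_.Circle M) :
    MulAction.stabilizer _root_.Circle x ≠ ⊥ := by
  intro hbot
  rw [MulAction.mem_fixedPoints] at hx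
  have h1 : (-1 : _root_.Circle) ∈ MulAction.stabilizer _root_.Circle x := hx (-1)
  rw [hbot, Subgroup.mem_bot] at h1
  have h2 := congrArg (fun z : _root_.Circle => (z : ℂ).re) h1
  norm_num at h2

end CircleAction

end Literature.Barriers.SmoothPoincare4

end
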